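import Literature.NumberTheory.GaloisRepresentations.DiscreteCochainsLongExact
import Literature.NumberTheory.GaloisRepresentations.ContinuousCohomologyMultiplicationSequences
import Literature.NumberTheory.GaloisRepresentations.ContinuousCohomologyAdditiveTransport
import HarnessLib

/-!
# Multiplication by a scalar on continuous cohomology: the exact sequences, and reduction of the
# coefficient ring modulo an ideal

Topic `NumberTheory/GaloisRepresentations`; namespace `Literature.NumberTheory.GaloisRepresentations`;
THEOREMS ONLY (no definition, no named fact, no `sorry`).

Let `Γ` be a compact topological group, `R` a commutative topological ring and `D` a discrete
`R`-module with a continuous `R`-linear `Γ`-action (`ContinuousRep Γ R D`).  For `T ∈ R` acting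
surjectively on `D` (`D` is `T`-divisible) the sequence `0 → D[T] → D →(T·) D → 0` is a short exact
sequence of discrete `Γ`-modules, and its long exact cohomology sequence reads
`… → Hⁿ(Γ, D) →(T·) Hⁿ(Γ, D) →δ Hⁿ⁺¹(Γ, D[T]) → Hⁿ⁺¹(Γ, D) →(T·) Hⁿ⁺¹(Γ, D) → …`
(R. Greenberg, *On the structure of certain Galois cohomology groups* (2006), proof of Prop. 3.2,
p. 358 L40 – p. 359 L9, and of Props. 4.1/4.2, p. 368 L38–40: "One determines the `ℤ_p`-corank by
reducing to the case of the finite modules `D[pⁿ]` … `D[Tⁿ]`").  This file records, in the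
element-level currency of the tree (`IsSES`, `cohomologyMap`, `DiscreteCochainsLongExact.lean`):

* `cohomologyMap_eq_smul` — the map induced on `Hⁿ` by the scalar endomorphism `d ↦ r·d` is
  multiplication by `r` (the `R`-module structure of continuous cohomology);
* `IsSES.exists_exact_smul` / `IsSES.exists_exact_smul_zero` — for a short exact sequence
  `0 → M₁ →ι M₂ →μ M₂ → 0` with `μ = T·`: `R`-linear maps `δ : Hⁿ(M₂) → Hⁿ⁺¹(M₁)`,
  `ι_* : Hⁿ⁺¹(M₁) → Hⁿ⁺¹(M₂)` with `Hⁿ(M₂) →(T·) Hⁿ(M₂) →δ Hⁿ⁺¹(M₁) →ι_* Hⁿ⁺¹(M₂) →(T·) Hⁿ⁺¹(M₂)`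
  exact, and `ι_* : H⁰(M₁) ↪ H⁰(M₂)` with image `H⁰(M₂)[T]`;
* `IsSES.exists_exact` / `IsSES.exists_exact_zero` — the same packaging for an arbitrary short
  exact sequence (mid-exactness and the connecting map, existence form);
* `continuousSMul_quotient_of_discreteTopology`, `exists_continuousRep_quotientRing`,
  `HAddEquivOfContinuousAddEquiv_smul` — a discrete `R`-module killed by an ideal `I` with its
  `Γ`-action is a continuous `R/I`-representation with THE SAME continuous cohomology, the
  identification being `R → R/I`-semilinear (cohomology does not see the scalars,
  `ContinuousCohomologyAdditiveTransport.lean`).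

## References
* R. Greenberg, *On the structure of certain Galois cohomology groups*, Doc. Math. Extra Vol.
  Coates (2006) 335–391, §3 A (proof of Prop. 3.2, pp. 358–359), §4 A (p. 368). [Greenberg2006]
* J.-P. Serre, *Galois Cohomology* (1997), I §2.2 (long exact sequence). [SerreGaloisCohomology1997]
-/

noncomputable section

open CategoryTheory Limits

namespace Literature.NumberTheory.GaloisRepresentations

open _root_.TopRep _root_.ContRepresentation _root_.ContinuousCohomology

set_option allowUnsafeReducibility true in
attribute [local reducible] CategoryTheory.Functor.mapHomologicalComplex

/-! ## §1. The scalar endomorphism induces the scalar on `Hⁿ` -/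

section Smul

variable {R : Type} [CommRing R] [TopologicalSpace R]
variable {Γ : Type} [Group Γ] [TopologicalSpace Γ] [IsTopologicalGroup Γ]
variable {D : Type} [AddCommGroup D] [Module R D] [TopologicalSpace D] [DiscreteTopology D]
  [ContinuousSMul R D]
variable (τ : ContinuousRep Γ R D)

/-- **The endomorphism `d ↦ r·d` of a discrete `Γ`-module induces multiplication by `r` on
`Hⁿ(Γ, D)`** (the `R`-module structure of Mathlib's continuous cohomology comes from the
coefficients; on homogeneous cochains the induced map is again `r·`).
[cite: Greenberg2006, §3 A (proof of Prop. 3.2, p. 359 L4–9: "the composite map `D → λD → D` is multiplication by `λ`")] -/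
theorem cohomologyMap_eq_smul (μ : τ.toTopRep ⟶ τ.toTopRep) (r : R) (hμ : ∀ d : D, μ.hom d = r • d)
    (n : ℕ) (c : continuousCohomology n τ.toTopRep) : cohomologyMap μ n c = r • c := by
  have hres : ∀ (m : ℕ) (v : resolutionX τ.toTopRep m), (resolutionHom μ m).hom v = r • v := by
    intro m
    induction m with
    | zero => intro v; exact hμ v
    | succ m ih =>
      intro F
      ext x
      rw [resolutionHom_succ_hom_apply, ih, ContinuousMap.smul_apply]
  have hcoch : ∀ (i : ℕ) (σ : (homogeneousCochains τ.toTopRep).X i),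
      (cochainsHom μ).f i σ = r • σ := fun i σ =>
    Subtype.ext (by rw [cochainsHom_f_coe, hres]; rfl)
  obtain ⟨σ, hσ, rfl⟩ :=
    cxClass_surjective (homogeneousCochains τ.toTopRep) n (n + 1) (up_nat_next n) c
  have hσr : (homogeneousCochains τ.toTopRep).d n (n + 1) (r • σ) = 0 := by
    rw [map_smul, hσ, smul_zero]
  change HomologicalComplex.homologyMap (cochainsHom μ) n _ = _
  rw [homologyMap_cxClass (cochainsHom μ) n (n + 1) (up_nat_next n) σ hσ (r • σ) hσr
    (hcoch n σ).symm, cxClass_smul]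

end Smul

/-! ## §2. Long exact sequences in existence form -/

section LES

variable {R : Type} [CommRing R] [TopologicalSpace R]
variable {Γ : Type} [Group Γ] [TopologicalSpace Γ] [IsTopologicalGroup Γ] [CompactSpace Γ]
variable {M₁ : Type} [AddCommGroup M₁] [Module R M₁] [TopologicalSpace M₁] [DiscreteTopology M₁]
  [ContinuousSMul R M₁]
variable {M₂ : Type} [AddCommGroup M₂] [Module R M₂] [TopologicalSpace M₂] [DiscreteTopology M₂]
  [ContinuousSMul R M₂]
variable {M₃ : Type} [AddCommGroup M₃] [Module R M₃] [TopologicalSpace M₃] [DiscreteTopology M₃]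
  [ContinuousSMul R M₃]
variable {ρ₁ : ContinuousRep Γ R M₁} {ρ₂ : ContinuousRep Γ R M₂} {ρ₃ : ContinuousRep Γ R M₃}
variable {f : ρ₁.toTopRep ⟶ ρ₂.toTopRep} {g : ρ₂.toTopRep ⟶ ρ₃.toTopRep}

/-- **The long exact sequence around `Hⁿ⁺¹`, existence form**: for a short exact sequence of
discrete `Γ`-modules there are `R`-linear maps `g_* : Hⁿ(M₂) → Hⁿ(M₃)`, `δ : Hⁿ(M₃) → Hⁿ⁺¹(M₁)`,
`f_* : Hⁿ⁺¹(M₁) → Hⁿ⁺¹(M₂)`, `g_* : Hⁿ⁺¹(M₂) → Hⁿ⁺¹(M₃)` with `g_* , δ, f_*, g_*` consecutively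
exact. [cite: SerreGaloisCohomology1997, I §2.2 (Prop. on the long exact sequence)] -/
theorem IsSES.exists_exact (h : IsSES f g) (n : ℕ) :
    ∃ (gn : ρ₂.H n →ₗ[R] ρ₃.H n) (δ : ρ₃.H n →ₗ[R] ρ₁.H (n + 1))
      (f₁ : ρ₁.H (n + 1) →ₗ[R] ρ₂.H (n + 1)) (g₁ : ρ₂.H (n + 1) →ₗ[R] ρ₃.H (n + 1)),
      Function.Exact gn δ ∧ Function.Exact δ f₁ ∧ Function.Exact f₁ g₁ := by
  obtain ⟨δ, h1, h2, h3, h4⟩ := h.exists_connectingHom n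
  refine ⟨(cohomologyMap g n).hom.toLinearMap, δ, (cohomologyMap f (n + 1)).hom.toLinearMap,
    (cohomologyMap g (n + 1)).hom.toLinearMap, ?_, ?_, ?_⟩
  · intro γ
    exact ⟨fun hγ => h2 γ hγ, by rintro ⟨b, rfl⟩; exact h3 b⟩
  · intro c
    exact ⟨fun hc => h1 c hc, by rintro ⟨γ, rfl⟩; exact h4 γ⟩
  · intro c
    exact ⟨fun hc => h.exists_cohomologyMap_eq_of_cohomologyMap_eq_zero (n + 1) c hc,
      by rintro ⟨a, rfl⟩; exact h.cohomologyMap_comp_apply_eq_zero' (n + 1) a⟩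

/-- **Degree `0` of the long exact sequence, existence form**: `0 → H⁰(M₁) →f_* H⁰(M₂) →g_* H⁰(M₃)`
with `f_*` injective and the pair exact. [cite: SerreGaloisCohomology1997, I §2.2 (Prop. on the long exact sequence)] -/
theorem IsSES.exists_exact_zero (h : IsSES f g) :
    ∃ (f₀ : ρ₁.H 0 →ₗ[R] ρ₂.H 0) (g₀ : ρ₂.H 0 →ₗ[R] ρ₃.H 0),
      Function.Injective f₀ ∧ Function.Exact f₀ g₀ := by
  refine ⟨(cohomologyMap f 0).hom.toLinearMap, (cohomologyMap g 0).hom.toLinearMap,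
    h.cohomologyMap_zero_injective, fun c => ⟨fun hc => ?_, ?_⟩⟩
  · exact h.exists_cohomologyMap_eq_of_cohomologyMap_eq_zero 0 c hc
  · rintro ⟨a, rfl⟩; exact h.cohomologyMap_comp_apply_eq_zero' 0 a

variable {μ : ρ₂.toTopRep ⟶ ρ₂.toTopRep}

/-- **The long exact sequence of `0 → M₁ →ι M₂ →(T·) M₂ → 0`, existence form**: `R`-linear
`δ : Hⁿ(M₂) → Hⁿ⁺¹(M₁)` and `ι_* : Hⁿ⁺¹(M₁) → Hⁿ⁺¹(M₂)` with
`Hⁿ(M₂) →(T·) Hⁿ(M₂) →δ Hⁿ⁺¹(M₁) →ι_* Hⁿ⁺¹(M₂) →(T·) Hⁿ⁺¹(M₂)` exact (`cohomologyMap_eq_smul`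
identifies `μ_*` with `T·`). [cite: Greenberg2006, §3 A (proof of Prop. 3.2, p. 358 L40 – p. 359 L9)] -/
theorem IsSES.exists_exact_smul (h : IsSES f μ) {T : R} (hμ : ∀ m : M₂, μ.hom m = T • m) (n : ℕ) :
    ∃ (δ : ρ₂.H n →ₗ[R] ρ₁.H (n + 1)) (ι₁ : ρ₁.H (n + 1) →ₗ[R] ρ₂.H (n + 1)),
      Function.Exact (T • (LinearMap.id : ρ₂.H n →ₗ[R] ρ₂.H n)) δ ∧ Function.Exact δ ι₁ ∧
        Function.Exact ι₁ (T • (LinearMap.id : ρ₂.H (n + 1) →ₗ[R] ρ₂.H (n + 1))) := by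
  -- `μ_* = T·` on `Hⁿ` and `Hⁿ⁺¹` (`cohomologyMap_eq_smul`)
  obtain ⟨δ', k1, k2, k3, k4⟩ := h.exists_connectingHom n
  refine ⟨δ', (cohomologyMap f (n + 1)).hom.toLinearMap, ?_, ?_, ?_⟩
  · intro γ
    constructor
    · intro hγ
      obtain ⟨b, hb⟩ := k2 γ hγ
      refine ⟨b, ?_⟩
      change T • b = γ
      rw [← cohomologyMap_eq_smul ρ₂ μ T hμ n b]; exact hb
    · rintro ⟨b, rfl⟩
      have := k3 b
      rwa [cohomologyMap_eq_smul ρ₂ μ T hμ n b] at this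
  · intro c
    exact ⟨fun hc => k1 c hc, by rintro ⟨γ, rfl⟩; exact k4 γ⟩
  · intro c
    constructor
    · intro hc
      have hc' : cohomologyMap μ (n + 1) c = 0 := by
        rw [cohomologyMap_eq_smul ρ₂ μ T hμ (n + 1) c]; exact hc
      exact h.exists_cohomologyMap_eq_of_cohomologyMap_eq_zero (n + 1) c hc'
    · rintro ⟨a, rfl⟩
      have := h.cohomologyMap_comp_apply_eq_zero' (n + 1) a
      rw [cohomologyMap_eq_smul ρ₂ μ T hμ (n + 1)] at this
      exact this

/-- **Degree `0` of `0 → M₁ →ι M₂ →(T·) M₂ → 0`**: `ι_* : H⁰(M₁) → H⁰(M₂)` is injective with image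
`H⁰(M₂)[T]`. [cite: Greenberg2006, §3 A (proof of Prop. 3.2, p. 358 L40 – p. 359 L9)] -/
theorem IsSES.exists_exact_smul_zero (h : IsSES f μ) {T : R} (hμ : ∀ m : M₂, μ.hom m = T • m) :
    ∃ (ι₀ : ρ₁.H 0 →ₗ[R] ρ₂.H 0), Function.Injective ι₀ ∧
      Function.Exact ι₀ (T • (LinearMap.id : ρ₂.H 0 →ₗ[R] ρ₂.H 0)) := by
  refine ⟨(cohomologyMap f 0).hom.toLinearMap, h.cohomologyMap_zero_injective, fun c => ⟨?_, ?_⟩⟩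
  · intro hc
    have hc' : cohomologyMap μ 0 c = 0 := by
      rw [cohomologyMap_eq_smul ρ₂ μ T hμ 0 c]; exact hc
    exact h.exists_cohomologyMap_eq_of_cohomologyMap_eq_zero 0 c hc'
  · rintro ⟨a, rfl⟩
    have := h.cohomologyMap_comp_apply_eq_zero' 0 a
    rw [cohomologyMap_eq_smul ρ₂ μ T hμ 0] at this
    exact this

end LES

/-! ## §3. Passing to the coefficient ring `R/I` -/

section QuotientRing

variable {R : Type} [CommRing R] [TopologicalSpace R] [IsTopologicalRing R] (I : Ideal R)
variable {Γ : Type} [Group Γ] [TopologicalSpace Γ] [IsTopologicalGroup Γ]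
variable {M : Type} [AddCommGroup M] [Module R M] [Module (R ⧸ I) M] [IsScalarTower R (R ⧸ I) M]
  [TopologicalSpace M] [DiscreteTopology M] [ContinuousSMul R M]

omit [DiscreteTopology M] in
/-- A topological `R`-module which is an `R/I`-module (compatibly) is a topological `R/I`-module:
the action `R/I × M → M` is continuous because `R × M → R/I × M` is an open quotient map
(topological plumbing for "`D[P]` considered as a module over `(Λ/P)`").
[cite: Greenberg2006, §4 A (proof of Props. 4.1/4.2, p. 368 L49–52)] -/
theorem continuousSMul_quotient_of_discreteTopology : ContinuousSMul (R ⧸ I) M := by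
  refine ⟨?_⟩
  have hq : IsOpenQuotientMap (Prod.map (Ideal.Quotient.mk I) (id : M → M)) :=
    (QuotientRing.isOpenQuotientMap_mk I).prodMap IsOpenQuotientMap.id
  rw [hq.isQuotientMap.continuous_iff]
  have : (fun p : (R ⧸ I) × M => p.1 • p.2) ∘ Prod.map (Ideal.Quotient.mk I) id =
      fun p : R × M => p.1 • p.2 := by
    funext p
    simp only [Function.comp_apply, Prod.map_fst, Prod.map_snd, id_eq]
    rw [← Ideal.Quotient.algebraMap_eq, IsScalarTower.algebraMap_smul]
  rw [this]
  exact continuous_smul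

omit [IsTopologicalRing R] [IsTopologicalGroup Γ] [DiscreteTopology M] [ContinuousSMul R M] in
/-- **The same discrete `Γ`-module over the coefficient ring `R/I`** (existence form): for a
continuous `R`-linear representation on an `R/I`-module `M` (compatible structures) there is a
continuous `R/I`-linear representation with the same action ("`D[P]` considered as a module over
the formal power series ring `(Λ/P)`"). [cite: Greenberg2006, §4 A (proof of Props. 4.1/4.2, p. 368 L49–52)] -/
theorem exists_continuousRep_quotientRing (σ : ContinuousRep Γ R M) :
    ∃ σ' : ContinuousRep Γ (R ⧸ I) M, ∀ (g : Γ) (m : M), σ' g m = σ g m := by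
  have hs : Function.Surjective (algebraMap R (R ⧸ I)) := Ideal.Quotient.mk_surjective
  let π : Γ →* (M →ₗ[R ⧸ I] M) :=
    { toFun := fun g => (σ g : M →ₗ[R] M).extendScalarsOfSurjective hs
      map_one' := by ext m; simp
      map_mul' := fun g g' => by ext m; simp }
  exact ⟨{ toRepresentation := π, continuous_smul := σ.continuous_smul }, fun _ _ => rfl⟩

/-- **The identification `Hⁿ(Γ, M)_R ≃+ Hⁿ(Γ, M)_{R/I}` is `R → R/I`-semilinear**: for the
representation over `R` and over `R/I` with the same action on the same discrete module, the
tree's `HAddEquivOfContinuousAddEquiv` (identity on cochains) carries `r·c` to `(r mod I)·c`.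
[cite: Greenberg2006, §4 A (proof of Props. 4.1/4.2, p. 368 L49–52: "`D[P]` considered as a module over the formal power series ring `(Λ/P)`")] -/
theorem HAddEquivOfContinuousAddEquiv_smul (σ : ContinuousRep Γ R M) (σ' : ContinuousRep Γ (R ⧸ I) M)
    (hσ : ∀ (g : Γ) (m : M), (ContinuousAddEquiv.refl M) (σ g m) = σ' g ((ContinuousAddEquiv.refl M) m))
    (n : ℕ) (r : R) (c : σ.H n) :
    haveI := continuousSMul_quotient_of_discreteTopology I (M := M)
    ContinuousRep.HAddEquivOfContinuousAddEquiv σ σ' (ContinuousAddEquiv.refl M) hσ n (r • c) =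
      (Ideal.Quotient.mk I r) • ContinuousRep.HAddEquivOfContinuousAddEquiv σ σ'
        (ContinuousAddEquiv.refl M) hσ n c := by
  haveI := continuousSMul_quotient_of_discreteTopology I (M := M)
  -- the two scalar endomorphisms as morphisms of topological representations
  let μ : σ.toTopRep ⟶ σ.toTopRep := TopRep.ofHom
    { toLinearMap := r • LinearMap.id
      cont := continuous_of_discreteTopology
      isIntertwining' := fun g => by ext m; simp }
  let μ' : σ'.toTopRep ⟶ σ'.toTopRep := TopRep.ofHom
    { toLinearMap := (Ideal.Quotient.mk I r) • LinearMap.id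
      cont := continuous_of_discreteTopology
      isIntertwining' := fun g => by ext m; simp }
  have h1 : r • c = cohomologyMap μ n c := (cohomologyMap_eq_smul σ μ r (fun _ => rfl) n c).symm
  have h2 : ∀ c' : σ'.H n, (Ideal.Quotient.mk I r) • c' = cohomologyMap μ' n c' :=
    fun c' => (cohomologyMap_eq_smul σ' μ' _ (fun _ => rfl) n c').symm
  rw [h1, h2]
  refine continuousCohomologyAddEquiv_map (X := σ.toTopRep) (X' := σ'.toTopRep)
    (Y := σ.toTopRep) (Y' := σ'.toTopRep) (ContinuousAddEquiv.refl M) hσ (ContinuousAddEquiv.refl M)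
    hσ (ContinuousMonoidHom.id Γ) (resIdHom μ) (resIdHom μ') (fun x => ?_) n c
  change r • x = (Ideal.Quotient.mk I r) • x
  rw [← Ideal.Quotient.algebraMap_eq, IsScalarTower.algebraMap_smul]

end QuotientRing

end Literature.NumberTheory.GaloisRepresentations

end
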